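import Summits.QuantumFields.YangMills.Theorems.BalabanUVNodesN15KingModelTorusReflectionPositivity
import Literature.Probability.LatticeModels.ReflectionPositivityPushforward
import HarnessLib

/-!
# BalabanUVNodes ∕ N15 — THE KING-MODEL RUNG (PART Ϗ-g): KING's TWO-LEVEL BLOCK-SPIN GAUSSIAN (2.4)∕(2.13) — fine field `ψ` AND block field `φ` jointly, with weight
# `exp(−½[N^{−d}⟨ψ,(c(−Δ)+m²)ψ⟩ + a‖φ − Qψ‖²])` — IS REFLECTION POSITIVE on the disjoint union of the two tori for the block-face reflection acting on BOTH levels: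
# the coupling `a‖φ − Qψ‖²` never crosses a block face, so the joint precision is ferromagnetic across the cut; its two marginals (coordinate projections =
# equivariant half-local maps) inherit reflection positivity — the structural reason why King's block-spin RG step preserves reflection positivity
# (Track A, DAG node N15 = NE2; FAN-OUT v1.1 §N15 s3 «KING-MODEL RUNG»; count-neutral)

HONEST FRAMING.  Count-neutral (cell `pub-ymgap`, seat `pub-ymgap-dag-n15-e` g37; `--supports stmt-QuantumFields-27366 --as helper` = K3⁸).  King's `A = 0`, `g = 0` model
([King1986] (2.4)–(2.6) p.652, (2.10)–(2.14) p.653, (4.5) p.670): on `V = Tor (fine N M) ⊕ Tor M` (fine torus `Π ℤ∕(N·M_μ)` ⊔ unit torus `Π ℤ∕M_μ`) the JOINT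
PRECISION of King's block-spin energy `E_φ(ψ) = a‖φ − Qψ‖² + N^{−d}⟨ψ,(c(−Δ)+m²)ψ⟩` (`King1986.Torus.energy`) is the block matrix `J = [[N^{−d}A₀, −aQᵀ],[−aQ, a·1]]`,
`A₀ = c(−Δ)+m²+a·Q*Q` (`Matrix.fromBlocks`, written out in every statement; no definition): ★ `kingJoint_form_eq_energy` (`v·Jv = E_{v∘inr}(v∘inl)`),
`kingJoint_posDef` (`a > 0`, `c ≥ 0`, `m² > 0`).  With the block-face reflection `σ_κ` acting on both summands (`Equiv.sumCongr σ_fine σ_unit`) and the half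
`P = fine half ⊔ unit half` (`M_κ` even): `J` is invariant (`kingJoint_invariant`), `σ` swaps `P` with its complement (`kingJoint_swap`), and the ONLY entries of `J`
across the cut are `A₀`'s mirror-diagonal ones — the couplings `−aQ(b,x)` join a fine site to ITS OWN block, never across a block face (`kingJoint_offDiag_zero`,
`kingJoint_diag_nonpos`).  Hence, by the precision criterion (Literature `GaussianPrecisionReflectionPositivity`), ★★★ **`kingTwoLevel_isReflectionPositive`**: the
two-level Gaussian field `N(0, J⁻¹)` on `ℝ^{fine ⊔ unit}` is REFLECTION POSITIVE on all bounded observables of the joint half; and by the push-forward theorem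
(Literature `ReflectionPositivityPushforward`) + the re-indexing law of Gaussian fields (`gaussianFieldOfKernel_map_precomp`) its two MARGINALS — the Gaussian fields
of the kernels `(J⁻¹)_{fine,fine}` and `(J⁻¹)_{unit,unit}` — are reflection positive for `(σ_fine, fine half)` resp. `(σ_unit, unit half)`
(★★★ `kingTwoLevel_fineMarginal_isReflectionPositive`, ★★★ `kingTwoLevel_blockMarginal_isReflectionPositive`).  §5: ★★ `kingJoint_inv_inr_inr` — THE UNIT–UNIT BLOCK
OF `J⁻¹` IS `(Δ^{(K)})⁻¹` (inverse of the Schur complement `a − a²N^dQA₀⁻¹Qᵀ` = King's DEFINITION (2.14) of the effective Laplacian; Mathlib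
`Matrix.invOf_fromBlocks₁₁_eq`), hence ★★★ **`effLaplacianField_isReflectionPositive_of_twoLevel`**: the reflection positivity of the Gaussian field of kernel `(Δ_eff)⁻¹` (for EVERY `N ≥ 1`,
`a > 0`; at `N = L^K`, `a = a_K` = part Ϗ-b's RG block-field law `N(0, blockCov)`) is OBTAINED as the push-forward of the joint reflection positivity under the block-coordinate projection.  Likewise ★★ `kingJoint_inv_inl_inl`
(`(J⁻¹)_{fine,fine} = N^dB⁻¹ = C^η`, King's fine covariance (2.17), `Matrix.invOf_fromBlocks₂₂_eq`) and ★★ `fineFreeField_isReflectionPositive_of_twoLevel`.  NOT Bałaban's objects; NOT a node discharge; nothing continuum ∕ `ℝ⁴` ∕ OS axioms ∕ mass gap ∕ Clay.  0 `sorry`, 0 `def`.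

WHAT THIS FILE PROVES (kernel).  §1 `Qmat_mulVec_dotProduct_self`, ★ `kingJoint_form_eq_energy`, `kingJoint_transpose`, `kingJoint_posDef`; §2 `kingJoint_invariant`,
`kingJoint_swap`, `kingJoint_offDiag_zero`, `kingJoint_diag_nonpos`, `kingJoint_cut_nonpos`; §3 ★★★ **`kingTwoLevel_isReflectionPositive`**, `kingTwoLevel_isReflectionInvariant`;
§4 ★★★ `kingTwoLevel_fineMarginal_isReflectionPositive`, ★★★ `kingTwoLevel_blockMarginal_isReflectionPositive`; §5 ★★ `kingJoint_inv_inr_inr`,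
★★★ **`effLaplacianField_isReflectionPositive_of_twoLevel`**, ★★ `kingJoint_inv_inl_inl`, ★★ `fineFreeField_isReflectionPositive_of_twoLevel`.

Locators (use): [King1986] (2.4)–(2.6) p.652, (2.10)–(2.14) pp.652–653, (4.5) p.670; Glimm–Jaffe 1987 §7.10 Thm. 7.10.3; FILS 1978 §2, Thm. 2.1; Biskup 2009 §5.1.
-/

noncomputable section

open scoped BigOperators
open Finset Matrix MeasureTheory

namespace Summit.QuantumFields.YangMills.BalabanUVNodes.N15KingModelRung.TorusRP

open Literature.MathematicalPhysics.QuantumFieldTheory (IsPosSemidefKernel gaussianFieldOfKernel)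
open Literature.MathematicalPhysics.QuantumFieldTheory.Balaban1983to89.B5Prop11Plancherel (Tor fine)
open Literature.MathematicalPhysics.QuantumFieldTheory.King1986.Torus (lapF lapF_coercive Qmat fineOp blockProj blockOf energy fineOp_coercive fineOp_transpose
  fineOp_isUnit lapF_isUnit effLaplacian effLaplacian_isUnit transpose_Qmat_mul_Qmat blockProj_form_nonneg)
open Literature.Probability.LatticeModels (IsReflectionPositive IsReflectionPositiveReal IsReflectionInvariant positiveEvents configReflect configReflect_apply
  gaussianField_isReflectionPositive_of_precision gaussianField_isReflectionInvariant_of_precision isPosSemidefKernel_inv_of_posDef cut_nonpos_of_nearestNeighbour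
  measurable_positiveEvents_of_coord gaussianFieldOfKernel_map_precomp)
open Summit.QuantumFields.YangMills.BalabanUVNodes.N15.TwoGrid (torRefl torRefl_torRefl torRefl_injective)
open Summit.QuantumFields.YangMills.BalabanUVNodes.N15.KingModel.SrcDiv (blockOf_torRefl fineOp_torRefl)
open Summit.QuantumFields.YangMills.BalabanUVNodes.N15KingModelRung.Curved (Qmat_torRefl)

variable {d : ℕ} (N : ℕ) [NeZero N] (M : Fin (d + 1) → ℕ) [∀ μ, NeZero (M μ)] (κ : Fin (d + 1))

/-! ## §1 The joint precision: its form is King's block-spin energy; symmetric; positive definite -/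

/-- `‖Qψ‖² = N^{−d}⟨ψ, (Q*Q)ψ⟩` (`QᵀQ = N^{−d}·blockProj`). [cite: King1986, (2.10) p.652, (4.36) p.674] -/
theorem Qmat_mulVec_dotProduct_self (ψ : Tor (fine N M) → ℝ) :
    (Qmat N M *ᵥ ψ) ⬝ᵥ (Qmat N M *ᵥ ψ) = ((N : ℝ) ^ (d + 1))⁻¹ * (ψ ⬝ᵥ (blockProj N M *ᵥ ψ)) := by
  rw [Matrix.dotProduct_mulVec (Qmat N M *ᵥ ψ) (Qmat N M) ψ, ← Matrix.mulVec_transpose, Matrix.mulVec_mulVec, transpose_Qmat_mul_Qmat,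
    Matrix.smul_mulVec, smul_dotProduct, smul_eq_mul, dotProduct_comm]

/-- ★ **THE JOINT FORM IS KING's BLOCK-SPIN ENERGY**: `v·Jv = a‖φ − Qψ‖² + N^{−d}⟨ψ, (c(−Δ)+m²)ψ⟩` with `ψ = v∘inl` (fine), `φ = v∘inr` (block), for
`J = [[N^{−d}A₀, −aQᵀ],[−aQ, a·1]]`. [cite: King1986, (2.4)–(2.6) p.652, (2.13)–(2.14) p.653] -/
theorem kingJoint_form_eq_energy (a c m2 : ℝ) (v : Tor (fine N M) ⊕ Tor M → ℝ) :
    v ⬝ᵥ (Matrix.fromBlocks (((N : ℝ) ^ (d + 1))⁻¹ • fineOp N M a c m2) (-(a • (Qmat N M)ᵀ)) (-(a • Qmat N M))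
        (a • (1 : Matrix (Tor M) (Tor M) ℝ)) *ᵥ v)
      = energy N M a c m2 (fun b => v (Sum.inr b)) (fun x => v (Sum.inl x)) := by
  set ψ : Tor (fine N M) → ℝ := fun x => v (Sum.inl x) with hψ
  set φ : Tor M → ℝ := fun b => v (Sum.inr b) with hφ
  have hv : v = Sum.elim ψ φ := by
    funext i; cases i <;> rfl
  have h1 : ψ ⬝ᵥ ((((N : ℝ) ^ (d + 1))⁻¹ • fineOp N M a c m2) *ᵥ ψ)
      = ((N : ℝ) ^ (d + 1))⁻¹ * (ψ ⬝ᵥ (lapF (fine N M) c m2 *ᵥ ψ) + a * (ψ ⬝ᵥ (blockProj N M *ᵥ ψ))) := by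
    rw [Matrix.smul_mulVec, dotProduct_smul, smul_eq_mul, fineOp, Matrix.add_mulVec, dotProduct_add, Matrix.smul_mulVec, dotProduct_smul, smul_eq_mul]
  have h2 : ψ ⬝ᵥ ((-(a • (Qmat N M)ᵀ)) *ᵥ φ) = -(a * (φ ⬝ᵥ (Qmat N M *ᵥ ψ))) := by
    rw [Matrix.neg_mulVec, dotProduct_neg, Matrix.smul_mulVec, dotProduct_smul, smul_eq_mul, Matrix.dotProduct_mulVec, Matrix.vecMul_transpose,
      dotProduct_comm]
  have h3 : φ ⬝ᵥ ((-(a • Qmat N M)) *ᵥ ψ + (a • (1 : Matrix (Tor M) (Tor M) ℝ)) *ᵥ φ) = -(a * (φ ⬝ᵥ (Qmat N M *ᵥ ψ))) + a * (φ ⬝ᵥ φ) := by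
    rw [dotProduct_add, Matrix.neg_mulVec, dotProduct_neg, Matrix.smul_mulVec, dotProduct_smul, smul_eq_mul, Matrix.smul_mulVec, Matrix.one_mulVec,
      dotProduct_smul, smul_eq_mul]
  have h4 := Qmat_mulVec_dotProduct_self N M ψ
  rw [hv, Matrix.fromBlocks_mulVec, Sum.elim_comp_inl, Sum.elim_comp_inr, sumElim_dotProduct_sumElim, dotProduct_add, h1, h2, h3, energy,
    sub_dotProduct, dotProduct_sub, dotProduct_sub, h4, dotProduct_comm (Qmat N M *ᵥ ψ) φ]
  ring

omit [NeZero N] [∀ μ, NeZero (M μ)] in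
/-- `J` is symmetric. [cite: King1986, (2.13) p.653] -/
theorem kingJoint_transpose (a c m2 : ℝ) [NeZero N] [∀ μ, NeZero (M μ)] :
    (Matrix.fromBlocks (((N : ℝ) ^ (d + 1))⁻¹ • fineOp N M a c m2) (-(a • (Qmat N M)ᵀ)) (-(a • Qmat N M))
        (a • (1 : Matrix (Tor M) (Tor M) ℝ)))ᵀ
      = Matrix.fromBlocks (((N : ℝ) ^ (d + 1))⁻¹ • fineOp N M a c m2) (-(a • (Qmat N M)ᵀ)) (-(a • Qmat N M))
        (a • (1 : Matrix (Tor M) (Tor M) ℝ)) := by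
  rw [Matrix.fromBlocks_transpose, Matrix.transpose_smul, fineOp_transpose, Matrix.transpose_neg, Matrix.transpose_neg, Matrix.transpose_smul,
    Matrix.transpose_smul, Matrix.transpose_transpose, Matrix.transpose_smul, Matrix.transpose_one]

/-- `J` is positive definite (`a > 0`, `c ≥ 0`, `m² > 0`): `v·Jv = a‖φ−Qψ‖² + N^{−d}⟨ψ,Bψ⟩ ≥ N^{−d}m²‖ψ‖²`, and `= a‖φ‖²` when `ψ = 0`. [cite: King1986, (2.4)–(2.6) p.652, (2.13) p.653] -/
theorem kingJoint_posDef {a c m2 : ℝ} (ha : 0 < a) (hc : 0 ≤ c) (hm : 0 < m2) :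
    (Matrix.fromBlocks (((N : ℝ) ^ (d + 1))⁻¹ • fineOp N M a c m2) (-(a • (Qmat N M)ᵀ)) (-(a • Qmat N M))
        (a • (1 : Matrix (Tor M) (Tor M) ℝ))).PosDef := by
  refine Matrix.PosDef.of_dotProduct_mulVec_pos ?_ fun v hv => ?_
  · show (_)ᴴ = _
    rw [Matrix.conjTranspose_eq_transpose_of_trivial, kingJoint_transpose]
  · rw [star_trivial, kingJoint_form_eq_energy, energy]
    set ψ : Tor (fine N M) → ℝ := fun x => v (Sum.inl x) with hψ
    set φ : Tor M → ℝ := fun b => v (Sum.inr b) with hφ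
    have hNd : 0 < ((N : ℝ) ^ (d + 1))⁻¹ := by
      have : (0 : ℝ) < N := by exact_mod_cast Nat.pos_of_ne_zero (NeZero.ne N)
      positivity
    have hsq : 0 ≤ (φ - Qmat N M *ᵥ ψ) ⬝ᵥ (φ - Qmat N M *ᵥ ψ) := Finset.sum_nonneg fun i _ => mul_self_nonneg _
    have hco := lapF_coercive (fine N M) c m2 hc ψ
    have hψψ : 0 ≤ ψ ⬝ᵥ ψ := Finset.sum_nonneg fun i _ => mul_self_nonneg _
    by_cases hψ0 : ψ = 0
    · -- then `φ ≠ 0` and the form is `a‖φ‖²`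
      have hφ0 : φ ≠ 0 := by
        intro h
        apply hv
        funext i
        cases i with
        | inl x => exact congr_fun hψ0 x
        | inr b => exact congr_fun h b
      have hφφ : 0 < φ ⬝ᵥ φ :=
        lt_of_le_of_ne (Finset.sum_nonneg fun i _ => mul_self_nonneg _) (Ne.symm fun h0 => hφ0 (dotProduct_self_eq_zero.mp h0))
      rw [hψ0, Matrix.mulVec_zero, sub_zero, Matrix.mulVec_zero, dotProduct_zero, mul_zero, add_zero]
      exact mul_pos ha hφφ
    · have hψp : 0 < ψ ⬝ᵥ ψ := lt_of_le_of_ne hψψ (Ne.symm fun h0 => hψ0 (dotProduct_self_eq_zero.mp h0))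
      nlinarith [mul_pos hNd (mul_pos hm hψp), mul_nonneg ha.le hsq]

/-! ## §2 The reflection on both levels: invariance, the swapped halves, the cut -/

/-- `J` is invariant under the block-face reflection acting on BOTH levels (`A₀`, `Q`, `1` are). [cite: King1986, (2.10)–(2.13) p.653] -/
theorem kingJoint_invariant (a c m2 : ℝ) (v w : Tor (fine N M) ⊕ Tor M) :
    Matrix.fromBlocks (((N : ℝ) ^ (d + 1))⁻¹ • fineOp N M a c m2) (-(a • (Qmat N M)ᵀ)) (-(a • Qmat N M)) (a • (1 : Matrix (Tor M) (Tor M) ℝ))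
        ((Equiv.sumCongr (Function.Involutive.toPerm (torRefl (fine N M) κ) torRefl_torRefl)
          (Function.Involutive.toPerm (torRefl M κ) torRefl_torRefl)) v)
        ((Equiv.sumCongr (Function.Involutive.toPerm (torRefl (fine N M) κ) torRefl_torRefl)
          (Function.Involutive.toPerm (torRefl M κ) torRefl_torRefl)) w)
      = Matrix.fromBlocks (((N : ℝ) ^ (d + 1))⁻¹ • fineOp N M a c m2) (-(a • (Qmat N M)ᵀ)) (-(a • Qmat N M))
        (a • (1 : Matrix (Tor M) (Tor M) ℝ)) v w := by
  rcases v with x | b <;> rcases w with y | b'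
  · show (((N : ℝ) ^ (d + 1))⁻¹ • fineOp N M a c m2) (torRefl (fine N M) κ x) (torRefl (fine N M) κ y) = (((N : ℝ) ^ (d + 1))⁻¹ • fineOp N M a c m2) x y
    rw [Matrix.smul_apply, Matrix.smul_apply, fineOp_torRefl]
  · show (-(a • (Qmat N M)ᵀ)) (torRefl (fine N M) κ x) (torRefl M κ b') = (-(a • (Qmat N M)ᵀ)) x b'
    rw [Matrix.neg_apply, Matrix.neg_apply, Matrix.smul_apply, Matrix.smul_apply, Matrix.transpose_apply, Matrix.transpose_apply, Qmat_torRefl]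
  · show (-(a • Qmat N M)) (torRefl M κ b) (torRefl (fine N M) κ y) = (-(a • Qmat N M)) b y
    rw [Matrix.neg_apply, Matrix.neg_apply, Matrix.smul_apply, Matrix.smul_apply, Qmat_torRefl]
  · show (a • (1 : Matrix (Tor M) (Tor M) ℝ)) (torRefl M κ b) (torRefl M κ b') = (a • (1 : Matrix (Tor M) (Tor M) ℝ)) b b'
    rw [Matrix.smul_apply, Matrix.smul_apply, Matrix.one_apply, Matrix.one_apply]
    simp only [torRefl_injective.eq_iff]

omit [NeZero N] [∀ μ, NeZero (M μ)] in
/-- The joint reflection is an involution. [cite: FILS1978, §2] -/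
theorem kingJoint_involutive :
    Function.Involutive (Equiv.sumCongr (Function.Involutive.toPerm (torRefl (fine N M) κ) torRefl_torRefl)
      (Function.Involutive.toPerm (torRefl M κ) torRefl_torRefl)) := by
  intro v
  rcases v with x | b
  · show Sum.inl (torRefl (fine N M) κ (torRefl (fine N M) κ x)) = Sum.inl x
    rw [torRefl_torRefl]
  · show Sum.inr (torRefl M κ (torRefl M κ b)) = Sum.inr b
    rw [torRefl_torRefl]

/-- The joint reflection SWAPS the joint half `fine half ⊔ unit half` with its complement (`M_κ` even). [cite: GlimmJaffe1987, §7.10 Thm. 7.10.2] -/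
theorem kingJoint_swap (hM : Even (M κ)) (v : Tor (fine N M) ⊕ Tor M) :
    (Equiv.sumCongr (Function.Involutive.toPerm (torRefl (fine N M) κ) torRefl_torRefl) (Function.Involutive.toPerm (torRefl M κ) torRefl_torRefl)) v
        ∈ {v : Tor (fine N M) ⊕ Tor M | Sum.elim (fun x : Tor (fine N M) => (x κ).val < fine N M κ / 2) (fun b : Tor M => (b κ).val < M κ / 2) v}
      ↔ v ∉ {v : Tor (fine N M) ⊕ Tor M | Sum.elim (fun x : Tor (fine N M) => (x κ).val < fine N M κ / 2) (fun b : Tor M => (b κ).val < M κ / 2) v} := by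
  rcases v with x | b
  · exact torRefl_mem_half_iff κ (even_fine N M κ hM) x
  · exact torRefl_mem_half_iff κ hM b

/-- **No entry of `J` joins two DISTINCT points of the joint half across the cut**: `A₀`'s bonds cross only to mirror images (part Ϗ-b), the couplings `−aQ(b,x)`
join a fine site to its own block (blocks of the fine half lie in the unit half), `a·1` is diagonal. [cite: King1986, (2.10)–(2.13) p.653] [cite: FILS1978, Thm. 2.1] -/
theorem kingJoint_offDiag_zero (hM : Even (M κ)) (a c m2 : ℝ) (v w : Tor (fine N M) ⊕ Tor M)
    (hv : v ∈ {v : Tor (fine N M) ⊕ Tor M | Sum.elim (fun x : Tor (fine N M) => (x κ).val < fine N M κ / 2) (fun b : Tor M => (b κ).val < M κ / 2) v})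
    (hw : w ∈ {v : Tor (fine N M) ⊕ Tor M | Sum.elim (fun x : Tor (fine N M) => (x κ).val < fine N M κ / 2) (fun b : Tor M => (b κ).val < M κ / 2) v})
    (hvw : v ≠ w) :
    Matrix.fromBlocks (((N : ℝ) ^ (d + 1))⁻¹ • fineOp N M a c m2) (-(a • (Qmat N M)ᵀ)) (-(a • Qmat N M)) (a • (1 : Matrix (Tor M) (Tor M) ℝ)) v
        ((Equiv.sumCongr (Function.Involutive.toPerm (torRefl (fine N M) κ) torRefl_torRefl)
          (Function.Involutive.toPerm (torRefl M κ) torRefl_torRefl)) w) = 0 := by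
  rcases v with x | b <;> rcases w with y | b'
  · have hxy : x ≠ y := fun h => hvw (by rw [h])
    show (((N : ℝ) ^ (d + 1))⁻¹ • fineOp N M a c m2) x (torRefl (fine N M) κ y) = 0
    rw [Matrix.smul_apply, fineOp_apply_torRefl_of_ne N M κ hM a c m2 hv hw hxy, smul_zero]
  · show (-(a • (Qmat N M)ᵀ)) x (torRefl M κ b') = 0
    have hbx : ((blockOf N M x) κ).val < M κ / 2 := (mem_half_fine_iff N M κ hM x).mp hv
    have hne : blockOf N M x ≠ torRefl M κ b' := fun h =>
      ((torRefl_mem_half_iff κ hM b').mp (by rw [← h]; exact hbx)) hw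
    rw [Matrix.neg_apply, Matrix.smul_apply, Matrix.transpose_apply, Qmat_apply_eq, if_neg hne, smul_zero, neg_zero]
  · show (-(a • Qmat N M)) b (torRefl (fine N M) κ y) = 0
    have hby : ((blockOf N M y) κ).val < M κ / 2 := (mem_half_fine_iff N M κ hM y).mp hw
    have hne : blockOf N M (torRefl (fine N M) κ y) ≠ b := by
      rw [blockOf_torRefl]
      exact fun h => ((torRefl_mem_half_iff κ hM (blockOf N M y)).mp (by rw [h]; exact hv)) hby
    rw [Matrix.neg_apply, Matrix.smul_apply, Qmat_apply_eq, if_neg hne, smul_zero, neg_zero]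
  · show (a • (1 : Matrix (Tor M) (Tor M) ℝ)) b (torRefl M κ b') = 0
    rw [Matrix.smul_apply, Matrix.one_apply_ne (torRefl_ne_of_mem_half κ hM hv hw).symm, smul_zero]

/-- The mirror-diagonal entries of `J` on the joint half are `≤ 0` (`N^{−d}A₀(x,σx) ≤ 0`; `a·1(b,σb) = 0`). [cite: King1986, (2.13) p.653] -/
theorem kingJoint_diag_nonpos (hM : Even (M κ)) (a : ℝ) {c : ℝ} (hc : 0 ≤ c) (m2 : ℝ) (v : Tor (fine N M) ⊕ Tor M)
    (hv : v ∈ {v : Tor (fine N M) ⊕ Tor M | Sum.elim (fun x : Tor (fine N M) => (x κ).val < fine N M κ / 2) (fun b : Tor M => (b κ).val < M κ / 2) v}) :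
    Matrix.fromBlocks (((N : ℝ) ^ (d + 1))⁻¹ • fineOp N M a c m2) (-(a • (Qmat N M)ᵀ)) (-(a • Qmat N M)) (a • (1 : Matrix (Tor M) (Tor M) ℝ)) v
        ((Equiv.sumCongr (Function.Involutive.toPerm (torRefl (fine N M) κ) torRefl_torRefl)
          (Function.Involutive.toPerm (torRefl M κ) torRefl_torRefl)) v) ≤ 0 := by
  rcases v with x | b
  · show (((N : ℝ) ^ (d + 1))⁻¹ • fineOp N M a c m2) x (torRefl (fine N M) κ x) ≤ 0
    rw [Matrix.smul_apply, smul_eq_mul]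
    exact mul_nonpos_of_nonneg_of_nonpos (by positivity) (fineOp_apply_torRefl_self_nonpos N M κ hM a hc m2 hv)
  · show (a • (1 : Matrix (Tor M) (Tor M) ℝ)) b (torRefl M κ b) ≤ 0
    rw [Matrix.smul_apply, Matrix.one_apply_ne (torRefl_ne_of_mem_half κ hM hv hv).symm, smul_zero]

/-- **The joint precision is ferromagnetic across the cut** (`M_κ` even, `c ≥ 0`). [cite: King1986, (2.13) p.653] [cite: FILS1978, Thm. 2.1] -/
theorem kingJoint_cut_nonpos (hM : Even (M κ)) (a : ℝ) {c : ℝ} (hc : 0 ≤ c) (m2 : ℝ) (u : Tor (fine N M) ⊕ Tor M → ℝ)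
    (hu : ∀ v, v ∉ {v : Tor (fine N M) ⊕ Tor M | Sum.elim (fun x : Tor (fine N M) => (x κ).val < fine N M κ / 2)
      (fun b : Tor M => (b κ).val < M κ / 2) v} → u v = 0) :
    ∑ v, ∑ w, u v * Matrix.fromBlocks (((N : ℝ) ^ (d + 1))⁻¹ • fineOp N M a c m2) (-(a • (Qmat N M)ᵀ)) (-(a • Qmat N M))
        (a • (1 : Matrix (Tor M) (Tor M) ℝ)) v
        ((Equiv.sumCongr (Function.Involutive.toPerm (torRefl (fine N M) κ) torRefl_torRefl)
          (Function.Involutive.toPerm (torRefl M κ) torRefl_torRefl)) w) * u w ≤ 0 :=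
  cut_nonpos_of_nearestNeighbour (fun v hv w hw hvw => kingJoint_offDiag_zero N M κ hM a c m2 v w hv hw hvw)
    (fun v hv => kingJoint_diag_nonpos N M κ hM a hc m2 v hv) u hu

/-! ## §3 The two-level Gaussian field is reflection positive -/

/-- ★★★ **KING's TWO-LEVEL BLOCK-SPIN GAUSSIAN IS REFLECTION POSITIVE**: the Gaussian field `N(0, J⁻¹)` on `ℝ^{Tor(fine) ⊔ Tor(unit)}` — the joint law of the fine field and
the block field under the weight `exp(−½[N^{−d}⟨ψ,(c(−Δ)+m²)ψ⟩ + a‖φ−Qψ‖²])` (2.4)∕(2.13) at `A = 0` — is reflection positive for the block-face reflection `σ_κ` acting on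
both levels and the joint half `{val x_κ < N·M_κ∕2} ⊔ {val b_κ < M_κ∕2}`, on ALL bounded observables measurable in the joint half (`M_κ` even, `a > 0`, `c ≥ 0`, `m² > 0`).
[cite: King1986, (2.4)–(2.6) p.652, (2.13)–(2.14) p.653] [cite: GlimmJaffe1987, §7.10 Thm. 7.10.3] [cite: FILS1978, §2, Thm. 2.1] -/
theorem kingTwoLevel_isReflectionPositive (hM : Even (M κ)) {a c m2 : ℝ} (ha : 0 < a) (hc : 0 ≤ c) (hm : 0 < m2) :
    IsReflectionPositive
      (gaussianFieldOfKernel fun v w : Tor (fine N M) ⊕ Tor M =>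
        (Matrix.fromBlocks (((N : ℝ) ^ (d + 1))⁻¹ • fineOp N M a c m2) (-(a • (Qmat N M)ᵀ)) (-(a • Qmat N M))
          (a • (1 : Matrix (Tor M) (Tor M) ℝ)))⁻¹ v w)
      (Equiv.sumCongr (Function.Involutive.toPerm (torRefl (fine N M) κ) torRefl_torRefl) (Function.Involutive.toPerm (torRefl M κ) torRefl_torRefl))
      {v : Tor (fine N M) ⊕ Tor M | Sum.elim (fun x : Tor (fine N M) => (x κ).val < fine N M κ / 2) (fun b : Tor M => (b κ).val < M κ / 2) v} :=
  gaussianField_isReflectionPositive_of_precision (kingJoint_posDef N M ha hc hm) _ (kingJoint_involutive N M κ) (kingJoint_invariant N M κ a c m2)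
    (kingJoint_swap N M κ hM) (kingJoint_cut_nonpos N M κ hM a hc m2)

/-- The two-level Gaussian field is reflection invariant. [cite: King1986, (2.13) p.653] -/
theorem kingTwoLevel_isReflectionInvariant {a c m2 : ℝ} (ha : 0 < a) (hc : 0 ≤ c) (hm : 0 < m2) :
    IsReflectionInvariant
      (gaussianFieldOfKernel fun v w : Tor (fine N M) ⊕ Tor M =>
        (Matrix.fromBlocks (((N : ℝ) ^ (d + 1))⁻¹ • fineOp N M a c m2) (-(a • (Qmat N M)ᵀ)) (-(a • Qmat N M))
          (a • (1 : Matrix (Tor M) (Tor M) ℝ)))⁻¹ v w)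
      (Equiv.sumCongr (Function.Involutive.toPerm (torRefl (fine N M) κ) torRefl_torRefl) (Function.Involutive.toPerm (torRefl M κ) torRefl_torRefl)) :=
  gaussianField_isReflectionInvariant_of_precision (kingJoint_posDef N M ha hc hm) _ (kingJoint_invariant N M κ a c m2)

/-! ## §4 The two marginals inherit reflection positivity (coordinate projections are equivariant and half-local) -/

/-- ★★★ **THE BLOCK MARGINAL IS REFLECTION POSITIVE**: the law of the block coordinates of the two-level field — the Gaussian field of the kernel `(J⁻¹)_{unit,unit}` — is
reflection positive for `(σ_unit, {val b_κ < M_κ∕2})` (re-indexing law `gaussianFieldOfKernel_map_precomp` + push-forward of reflection positivity).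
[cite: King1986, (2.14) p.653, (4.5) p.670] [cite: FILS1978, §2] [cite: Biskup2009, §5.1 Def. 5.2, Lemma 5.3] -/
theorem kingTwoLevel_blockMarginal_isReflectionPositive (hM : Even (M κ)) {a c m2 : ℝ} (ha : 0 < a) (hc : 0 ≤ c) (hm : 0 < m2) :
    IsReflectionPositive
      (gaussianFieldOfKernel fun b b' : Tor M =>
        (Matrix.fromBlocks (((N : ℝ) ^ (d + 1))⁻¹ • fineOp N M a c m2) (-(a • (Qmat N M)ᵀ)) (-(a • Qmat N M))
          (a • (1 : Matrix (Tor M) (Tor M) ℝ)))⁻¹ (Sum.inr b) (Sum.inr b'))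
      (Function.Involutive.toPerm (torRefl M κ) torRefl_torRefl) {b : Tor M | (b κ).val < M κ / 2} := by
  have hpsd := isPosSemidefKernel_inv_of_posDef (kingJoint_posDef N M ha hc hm)
  rw [← gaussianFieldOfKernel_map_precomp hpsd Sum.inr]
  refine (kingTwoLevel_isReflectionPositive N M κ hM ha hc hm).map_of_equivariant
    (measurable_pi_lambda (fun (σ : Tor (fine N M) ⊕ Tor M → ℝ) (b : Tor M) => σ (Sum.inr b)) fun b => measurable_pi_apply (Sum.inr b))
    (fun σ => ?_) (measurable_positiveEvents_of_coord fun b hb => ?_)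
  · funext b
    rfl
  · exact measurable_cylinderEvent_apply (i := Sum.inr b) (X := fun _ => ℝ) hb

/-- ★★★ **THE FINE MARGINAL IS REFLECTION POSITIVE**: the law of the fine coordinates — the Gaussian field of the kernel `(J⁻¹)_{fine,fine}` — is reflection positive for
`(σ_fine, {val x_κ < N·M_κ∕2})`. [cite: King1986, (2.13) p.653] [cite: FILS1978, §2] [cite: Biskup2009, §5.1 Def. 5.2, Lemma 5.3] -/
theorem kingTwoLevel_fineMarginal_isReflectionPositive (hM : Even (M κ)) {a c m2 : ℝ} (ha : 0 < a) (hc : 0 ≤ c) (hm : 0 < m2) :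
    IsReflectionPositive
      (gaussianFieldOfKernel fun x y : Tor (fine N M) =>
        (Matrix.fromBlocks (((N : ℝ) ^ (d + 1))⁻¹ • fineOp N M a c m2) (-(a • (Qmat N M)ᵀ)) (-(a • Qmat N M))
          (a • (1 : Matrix (Tor M) (Tor M) ℝ)))⁻¹ (Sum.inl x) (Sum.inl y))
      (Function.Involutive.toPerm (torRefl (fine N M) κ) torRefl_torRefl) {x : Tor (fine N M) | (x κ).val < fine N M κ / 2} := by
  have hpsd := isPosSemidefKernel_inv_of_posDef (kingJoint_posDef N M ha hc hm)
  rw [← gaussianFieldOfKernel_map_precomp hpsd Sum.inl]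
  refine (kingTwoLevel_isReflectionPositive N M κ hM ha hc hm).map_of_equivariant
    (measurable_pi_lambda (fun (σ : Tor (fine N M) ⊕ Tor M → ℝ) (x : Tor (fine N M)) => σ (Sum.inl x)) fun x => measurable_pi_apply (Sum.inl x))
    (fun σ => ?_) (measurable_positiveEvents_of_coord fun x hx => ?_)
  · funext x
    rfl
  · exact measurable_cylinderEvent_apply (i := Sum.inl x) (X := fun _ => ℝ) hx

/-! ## §5 The block marginal's covariance IS King's `(Δ^{(K)})⁻¹` (Schur complement = (2.14)); hence the RG block-field law's reflection positivity is INHERITED -/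

/-- ★★ **`(J⁻¹)_{unit,unit} = (Δ^{(K)})⁻¹`**: the unit–unit block of the inverse joint precision is the inverse of the SCHUR COMPLEMENT
`a·1 − (−aQ)(N^{−d}A₀)⁻¹(−aQᵀ) = a − a²N^dQA₀⁻¹Qᵀ = Δ^{(K)}` — King's definition (2.14) of the effective Laplacian (Mathlib `Matrix.invOf_fromBlocks₁₁_eq`; `c = N²`,
`N ≥ 1`, `a, m² > 0`). [cite: King1986, (2.13)–(2.14) p.653, (4.5) p.670] -/
theorem kingJoint_inv_inr_inr (hN1 : 1 ≤ N) {a m2 : ℝ} (ha : 0 < a) (hm : 0 < m2) (b b' : Tor M) :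
    (Matrix.fromBlocks (((N : ℝ) ^ (d + 1))⁻¹ • fineOp N M a ((N : ℝ) ^ 2) m2) (-(a • (Qmat N M)ᵀ)) (-(a • Qmat N M))
        (a • (1 : Matrix (Tor M) (Tor M) ℝ)))⁻¹ (Sum.inr b) (Sum.inr b')
      = (effLaplacian N M a ((N : ℝ) ^ 2) m2)⁻¹ b b' := by
  have hNd : ((N : ℝ) ^ (d + 1)) ≠ 0 := pow_ne_zero _ (by exact_mod_cast NeZero.ne N)
  have hdetA : IsUnit (fineOp N M a ((N : ℝ) ^ 2) m2).det :=
    (Matrix.isUnit_iff_isUnit_det _).mp (fineOp_isUnit N M ha.le (by positivity) hm)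
  -- `A = N^{−d}A₀` is invertible with `⅟A = N^d A₀⁻¹`
  letI iA : Invertible (((N : ℝ) ^ (d + 1))⁻¹ • fineOp N M a ((N : ℝ) ^ 2) m2) :=
    ⟨((N : ℝ) ^ (d + 1)) • (fineOp N M a ((N : ℝ) ^ 2) m2)⁻¹,
      by rw [Matrix.smul_mul, Matrix.mul_smul, smul_smul, mul_inv_cancel₀ hNd, one_smul, Matrix.nonsing_inv_mul _ hdetA],
      by rw [Matrix.smul_mul, Matrix.mul_smul, smul_smul, inv_mul_cancel₀ hNd, one_smul, Matrix.mul_nonsing_inv _ hdetA]⟩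
  have hiA : ⅟(((N : ℝ) ^ (d + 1))⁻¹ • fineOp N M a ((N : ℝ) ^ 2) m2) = ((N : ℝ) ^ (d + 1)) • (fineOp N M a ((N : ℝ) ^ 2) m2)⁻¹ := rfl
  -- the Schur complement is King's effective Laplacian
  have hS : a • (1 : Matrix (Tor M) (Tor M) ℝ) - (-(a • Qmat N M)) * ⅟(((N : ℝ) ^ (d + 1))⁻¹ • fineOp N M a ((N : ℝ) ^ 2) m2) * (-(a • (Qmat N M)ᵀ))
      = effLaplacian N M a ((N : ℝ) ^ 2) m2 := by
    rw [hiA, effLaplacian]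
    simp only [Matrix.neg_mul, Matrix.mul_neg, smul_neg, neg_neg, Matrix.smul_mul, Matrix.mul_smul, smul_smul]
    congr 2
    ring
  letI iS : Invertible (a • (1 : Matrix (Tor M) (Tor M) ℝ)
      - (-(a • Qmat N M)) * ⅟(((N : ℝ) ^ (d + 1))⁻¹ • fineOp N M a ((N : ℝ) ^ 2) m2) * (-(a • (Qmat N M)ᵀ))) :=
    (effLaplacian_isUnit N M hN1 ha hm).invertible.copy _ hS
  letI := Matrix.fromBlocks₁₁Invertible (((N : ℝ) ^ (d + 1))⁻¹ • fineOp N M a ((N : ℝ) ^ 2) m2) (-(a • (Qmat N M)ᵀ)) (-(a • Qmat N M))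
    (a • (1 : Matrix (Tor M) (Tor M) ℝ))
  rw [← Matrix.invOf_eq_nonsing_inv, Matrix.invOf_fromBlocks₁₁_eq, Matrix.fromBlocks_apply₂₂, Matrix.invOf_eq_nonsing_inv, hS]

/-- ★★★ **THE EFFECTIVE-LAPLACIAN FIELD's REFLECTION POSITIVITY, INHERITED FROM THE TWO-LEVEL GAUSSIAN**: for EVERY `N ≥ 1`, `a > 0`, `m² > 0` (`c = N²`) and even `M_κ`,
the Gaussian field of kernel `(Δ_eff)⁻¹ = (a − a²N^dQA₀⁻¹Qᵀ)⁻¹` on `Π ℤ∕M_μ` — the block marginal of the two-level field (`kingJoint_inv_inr_inr`) — is reflection positive for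
`(σ_κ, {val b_κ < M_κ∕2})`, as the push-forward of the joint reflection positivity under the block-coordinate projection.  (At `N = L^K`, `a = a_K` this is part Ϗ-b's
`blockFieldLaw_isReflectionPositive` for King's `dμ^{(K)}`, there proved by the precision criterion on `Δ^{(K)}`; here for general `N`, `a`.)
[cite: King1986, (2.13)–(2.14) p.653, (4.5) p.670] [cite: FILS1978, §2, Thm. 2.1] [cite: Biskup2009, §5.1 Lemma 5.3] -/
theorem effLaplacianField_isReflectionPositive_of_twoLevel (hN1 : 1 ≤ N) (hM : Even (M κ)) {a m2 : ℝ} (ha : 0 < a) (hm : 0 < m2) :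
    IsReflectionPositive (gaussianFieldOfKernel fun b b' : Tor M => (effLaplacian N M a ((N : ℝ) ^ 2) m2)⁻¹ b b')
      (Function.Involutive.toPerm (torRefl M κ) torRefl_torRefl) {b : Tor M | (b κ).val < M κ / 2} := by
  have hker : (fun b b' : Tor M => (effLaplacian N M a ((N : ℝ) ^ 2) m2)⁻¹ b b') = fun b b' : Tor M =>
      (Matrix.fromBlocks (((N : ℝ) ^ (d + 1))⁻¹ • fineOp N M a ((N : ℝ) ^ 2) m2) (-(a • (Qmat N M)ᵀ)) (-(a • Qmat N M))
        (a • (1 : Matrix (Tor M) (Tor M) ℝ)))⁻¹ (Sum.inr b) (Sum.inr b') := by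
    funext b b'
    rw [kingJoint_inv_inr_inr N M hN1 ha hm]
  rw [hker]
  exact kingTwoLevel_blockMarginal_isReflectionPositive N M κ hM ha (by positivity) hm

/-- ★★ **`(J⁻¹)_{fine,fine} = N^d·B⁻¹ = C^η`**: the fine–fine block of the inverse joint precision is the inverse of the Schur complement
`N^{−d}A₀ − (−aQᵀ)(a·1)⁻¹(−aQ) = N^{−d}(A₀ − a·Q*Q) = N^{−d}B` — King's fine covariance `C^η = N^dB⁻¹` (2.17) (Mathlib `Matrix.invOf_fromBlocks₂₂_eq`; `a > 0`, `c ≥ 0`, `m² > 0`).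
[cite: King1986, (2.13) p.653, (2.17) p.653] -/
theorem kingJoint_inv_inl_inl {a c m2 : ℝ} (ha : 0 < a) (hc : 0 ≤ c) (hm : 0 < m2) (x y : Tor (fine N M)) :
    (Matrix.fromBlocks (((N : ℝ) ^ (d + 1))⁻¹ • fineOp N M a c m2) (-(a • (Qmat N M)ᵀ)) (-(a • Qmat N M))
        (a • (1 : Matrix (Tor M) (Tor M) ℝ)))⁻¹ (Sum.inl x) (Sum.inl y)
      = (N : ℝ) ^ (d + 1) * (lapF (fine N M) c m2)⁻¹ x y := by
  have hNd : ((N : ℝ) ^ (d + 1)) ≠ 0 := pow_ne_zero _ (by exact_mod_cast NeZero.ne N)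
  have hdetB : IsUnit (lapF (fine N M) c m2).det := (Matrix.isUnit_iff_isUnit_det _).mp (lapF_isUnit N M hc hm)
  letI iD : Invertible (a • (1 : Matrix (Tor M) (Tor M) ℝ)) :=
    ⟨a⁻¹ • (1 : Matrix (Tor M) (Tor M) ℝ), by rw [Matrix.smul_mul, Matrix.mul_smul, smul_smul, inv_mul_cancel₀ ha.ne', one_smul, Matrix.one_mul],
      by rw [Matrix.smul_mul, Matrix.mul_smul, smul_smul, mul_inv_cancel₀ ha.ne', one_smul, Matrix.one_mul]⟩
  have hiD : ⅟(a • (1 : Matrix (Tor M) (Tor M) ℝ)) = a⁻¹ • (1 : Matrix (Tor M) (Tor M) ℝ) := rfl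
  -- the Schur complement is `N^{−d}B`
  have hS : ((N : ℝ) ^ (d + 1))⁻¹ • fineOp N M a c m2 - (-(a • (Qmat N M)ᵀ)) * ⅟(a • (1 : Matrix (Tor M) (Tor M) ℝ)) * (-(a • Qmat N M))
      = ((N : ℝ) ^ (d + 1))⁻¹ • lapF (fine N M) c m2 := by
    rw [hiD, fineOp]
    simp only [Matrix.neg_mul, Matrix.mul_neg, smul_neg, neg_neg, Matrix.smul_mul, Matrix.mul_smul, smul_smul, Matrix.mul_one,
      transpose_Qmat_mul_Qmat, smul_add]
    rw [show a * (a⁻¹ * a * ((N : ℝ) ^ (d + 1))⁻¹) = ((N : ℝ) ^ (d + 1))⁻¹ * a by rw [inv_mul_cancel₀ ha.ne', one_mul, mul_comm],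
      add_sub_cancel_right]
  letI iS : Invertible (((N : ℝ) ^ (d + 1))⁻¹ • fineOp N M a c m2 - (-(a • (Qmat N M)ᵀ)) * ⅟(a • (1 : Matrix (Tor M) (Tor M) ℝ)) * (-(a • Qmat N M))) :=
    Invertible.copy ⟨((N : ℝ) ^ (d + 1)) • (lapF (fine N M) c m2)⁻¹,
      by rw [Matrix.smul_mul, Matrix.mul_smul, smul_smul, mul_inv_cancel₀ hNd, one_smul, Matrix.nonsing_inv_mul _ hdetB],
      by rw [Matrix.smul_mul, Matrix.mul_smul, smul_smul, inv_mul_cancel₀ hNd, one_smul, Matrix.mul_nonsing_inv _ hdetB]⟩ _ hS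
  letI := Matrix.fromBlocks₂₂Invertible (((N : ℝ) ^ (d + 1))⁻¹ • fineOp N M a c m2) (-(a • (Qmat N M)ᵀ)) (-(a • Qmat N M))
    (a • (1 : Matrix (Tor M) (Tor M) ℝ))
  rw [← Matrix.invOf_eq_nonsing_inv, Matrix.invOf_fromBlocks₂₂_eq, Matrix.fromBlocks_apply₁₁]
  show (((N : ℝ) ^ (d + 1)) • (lapF (fine N M) c m2)⁻¹) x y = _
  rw [Matrix.smul_apply, smul_eq_mul]

/-- ★★ **THE FINE FREE FIELD's REFLECTION POSITIVITY, INHERITED**: King's fine covariance `C^η = N^dB⁻¹` is the fine marginal of the two-level field, so `N(0, C^η)` is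
reflection positive as a push-forward of the joint law (a second route to part Ϗ-a, `M_κ` even, `a > 0`, `c ≥ 0`, `m² > 0`). [cite: King1986, (2.13) p.653, (2.17) p.653] [cite: FILS1978, §2] -/
theorem fineFreeField_isReflectionPositive_of_twoLevel (hM : Even (M κ)) {a c m2 : ℝ} (ha : 0 < a) (hc : 0 ≤ c) (hm : 0 < m2) :
    IsReflectionPositive (gaussianFieldOfKernel fun x y : Tor (fine N M) => (N : ℝ) ^ (d + 1) * (lapF (fine N M) c m2)⁻¹ x y)
      (Function.Involutive.toPerm (torRefl (fine N M) κ) torRefl_torRefl) {x : Tor (fine N M) | (x κ).val < fine N M κ / 2} := by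
  have hker : (fun x y : Tor (fine N M) => (N : ℝ) ^ (d + 1) * (lapF (fine N M) c m2)⁻¹ x y) = fun x y : Tor (fine N M) =>
      (Matrix.fromBlocks (((N : ℝ) ^ (d + 1))⁻¹ • fineOp N M a c m2) (-(a • (Qmat N M)ᵀ)) (-(a • Qmat N M))
        (a • (1 : Matrix (Tor M) (Tor M) ℝ)))⁻¹ (Sum.inl x) (Sum.inl y) := by
    funext x y
    rw [kingJoint_inv_inl_inl N M ha hc hm]
  rw [hker]
  exact kingTwoLevel_fineMarginal_isReflectionPositive N M κ hM ha hc hm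

end Summit.QuantumFields.YangMills.BalabanUVNodes.N15KingModelRung.TorusRP
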